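import Mathlib.LinearAlgebra.Matrix.NonsingularInverse
import Mathlib.Data.Real.Basic
import Mathlib.Tactic.Linarith
import HarnessLib

/-!
# The primal–dual algorithm and its associated restricted primal (Luenberger–Ye, §4.6)

[LY08] = D. G. Luenberger, Y. Ye, *Linear and Nonlinear Programming* [LuenbergerYe2008], chapter
"Duality" (Ch. 4 in the held copy `book:luenberger2008-linear-nonlinear-programming` and in the
Springer 2008 printing), §4.6 "The primal–dual algorithm": the primal (15)
`minimize cᵀx subject to Ax = b, x ≥ 0`, the dual (16) `maximize λᵀb subject to λᵀA ≤ cᵀ`, the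
index set `P = {i : λᵀa_i = c_i}` of a dual feasible `λ`, the associated restricted primal (17)
`minimize 1ᵀy subject to Ax + y = b, x ≥ 0, x_i = 0 (i ∉ P), y ≥ 0` and restricted dual (18)
`maximize uᵀb subject to uᵀa_i ≤ 0 (i ∈ P), u ≤ 1`, the **Primal–Dual Optimality Theorem**,
Steps 1–3 with the move `λ_ε = λ₀ + εu₀` and the ratio
`ε₀ = min {(c_j − λ₀ᵀa_j)/u₀ᵀa_j : u₀ᵀa_j > 0}`, and the convergence observations.

Results recorded:
* `primalDual_value_eq` / `primalDual_optimality` — the Primal–Dual Optimality Theorem: if `λ` is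
  dual feasible and `x` is feasible for the restricted primal with `y = 0` (so `x_i = 0` off `P`),
  then `cᵀx = λᵀAx = λᵀb`, hence `x` and `λ` are optimal (Lemma 1 of §4.2);
* `restricted_weak_duality` and `restricted_complementary_slackness` — for the pair (17)/(18):
  `uᵀb ≤ 1ᵀy`, and when the values are equal, `x_i > 0 ⇒ uᵀa_i = 0` (used in the convergence
  argument: such indices stay in the new `P`);
* Step 3, first case: `pdMove_dual_feasible_of_nonpos` (`u₀ᵀA ≤ 0` ⇒ `λ_ε` dual feasible for all
  `ε ≥ 0`), `pdMove_dotProduct_rhs` (`λ_εᵀb = λ₀ᵀb + εu₀ᵀb`), `dual_unbounded_of_nonpos` (with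
  `u₀ᵀb > 0` the dual objective is unbounded) and `primal_infeasible_of_nonpos` (then the primal
  (15) has no feasible solution — proved directly: `u₀ᵀb = u₀ᵀAx ≤ 0`);
* Step 3, ratio: `pdRatio_pos` (`(c_j − λ₀ᵀa_j)/u₀ᵀa_j > 0` for `j ∉ P` with `u₀ᵀa_j > 0`),
  `pdMove_dual_feasible_of_le_ratio` (`0 ≤ ε ≤` every ratio keeps dual feasibility),
  `pdMove_tight_at_ratio` (at `ε₀` the `k`th constraint becomes active: `k` joins `P`),
  `pdMove_active_of_orthogonal` (`u₀ᵀa_i = 0`, `i ∈ P` ⇒ `i` stays in `P`), and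
  `pdMove_objective_gt` (the dual objective increases by `ε₀u₀ᵀb > 0`).

Published results only (Lean placement rule): every public declaration carries its
`[cite: LuenbergerYe2008, §4.6 …]` locator.
-/

namespace Literature.Analysis.Convex.PrimalDualRestrictedPrimal

open Matrix

variable {m n : Type*} [Fintype m] [Fintype n]

/-- The primal–dual move of Step 3: `λ_ε = λ₀ + εu₀`. [cite: LuenbergerYe2008, §4.6 Step 3
(λ = λ₀ + ε₀u₀) and the family λ_ε = λ₀ + εu₀] -/
def pdMove (lam0 u : m → ℝ) (ε : ℝ) : m → ℝ := lam0 + ε • u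

/-- **Primal–Dual Optimality Theorem**, value identity: if `λᵀA` agrees with `cᵀ` on the support
of `x` (i.e. `x_i = 0` whenever `λᵀa_i ≠ c_i`) and `Ax = b`, then `cᵀx = λᵀAx = λᵀb`.
[cite: LuenbergerYe2008, §4.6 Primal-Dual Optimality Theorem, proof] -/
theorem primalDual_value_eq (A : Matrix m n ℝ) {b lam : m → ℝ} {c x : n → ℝ}
    (hAx : A *ᵥ x = b) (hP : ∀ j, (Aᵀ *ᵥ lam) j ≠ c j → x j = 0) :
    c ⬝ᵥ x = lam ⬝ᵥ b := by
  have h1 : c ⬝ᵥ x = (Aᵀ *ᵥ lam) ⬝ᵥ x := by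
    unfold dotProduct
    refine Finset.sum_congr rfl fun j _ => ?_
    by_cases h : (Aᵀ *ᵥ lam) j = c j
    · rw [h]
    · rw [hP j h, mul_zero, mul_zero]
  rw [h1, mulVec_transpose, ← dotProduct_mulVec, hAx]

/-- **Primal–Dual Optimality Theorem.** Suppose `λ` is feasible for the dual (16) and `x`
(with `y = 0`) is feasible for the associated restricted primal (17): `Ax = b`, `x ≥ 0`,
`x_i = 0` for `i ∉ P`. Then `x` is optimal for the primal (15) and `λ` for the dual (16)
(Lemma 1 of §4.2: `cᵀx' ≥ λᵀAx' = λᵀb = cᵀx` and `μᵀb = μᵀAx ≤ cᵀx`).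
[cite: LuenbergerYe2008, §4.6 Primal-Dual Optimality Theorem] -/
theorem primalDual_optimality (A : Matrix m n ℝ) {b lam : m → ℝ} {c x : n → ℝ}
    (hlam : ∀ j, (Aᵀ *ᵥ lam) j ≤ c j) (hAx : A *ᵥ x = b) (hx : ∀ j, 0 ≤ x j)
    (hP : ∀ j, (Aᵀ *ᵥ lam) j ≠ c j → x j = 0) :
    (∀ x' : n → ℝ, A *ᵥ x' = b → (∀ j, 0 ≤ x' j) → c ⬝ᵥ x ≤ c ⬝ᵥ x') ∧
      ∀ μ : m → ℝ, (∀ j, (Aᵀ *ᵥ μ) j ≤ c j) → μ ⬝ᵥ b ≤ lam ⬝ᵥ b := by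
  have hval := primalDual_value_eq A hAx hP
  refine ⟨fun x' hAx' hx' => ?_, fun μ hμ => ?_⟩
  · rw [hval, ← hAx', dotProduct_mulVec, ← mulVec_transpose]
    exact Finset.sum_le_sum fun j _ => mul_le_mul_of_nonneg_right (hlam j) (hx' j)
  · rw [← hval, ← hAx, dotProduct_mulVec, ← mulVec_transpose]
    exact Finset.sum_le_sum fun j _ => mul_le_mul_of_nonneg_right (hμ j) (hx j)

/-- Weak duality for the restricted pair (17)/(18): if `Ax + y = b`, `x ≥ 0` with `x_i = 0` off
`P`, `y ≥ 0`, and `u` satisfies `uᵀa_i ≤ 0` on `P`, `u ≤ 1`, then `uᵀb ≤ 1ᵀy`.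
[cite: LuenbergerYe2008, §4.6 (17), (18) (the associated restricted primal and its dual)] -/
theorem restricted_weak_duality (A : Matrix m n ℝ) {b y u : m → ℝ} {x : n → ℝ} (P : Set n)
    (hAxy : A *ᵥ x + y = b) (hx : ∀ j, 0 ≤ x j) (hxP : ∀ j, j ∉ P → x j = 0) (hy : ∀ i, 0 ≤ y i)
    (huP : ∀ j, j ∈ P → (Aᵀ *ᵥ u) j ≤ 0) (hu1 : ∀ i, u i ≤ 1) :
    u ⬝ᵥ b ≤ ∑ i, y i := by
  rw [← hAxy, dotProduct_add, dotProduct_mulVec, ← mulVec_transpose]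
  have h1 : (Aᵀ *ᵥ u) ⬝ᵥ x ≤ 0 := by
    unfold dotProduct
    refine Finset.sum_nonpos fun j _ => ?_
    by_cases hj : j ∈ P
    · exact mul_nonpos_of_nonpos_of_nonneg (huP j hj) (hx j)
    · rw [hxP j hj, mul_zero]
  have h2 : u ⬝ᵥ y ≤ ∑ i, y i := by
    unfold dotProduct
    exact Finset.sum_le_sum fun i _ => by nlinarith [hu1 i, hy i]
  linarith

/-- Complementary slackness for the restricted pair: if in addition the values are equal,
`uᵀb = 1ᵀy` (optimal `x, y` and `u₀`), then `x_i > 0 ⇒ u₀ᵀa_i = 0` — "by complementary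
slackness u₀ᵀa_i = 0 for such an i". [cite: LuenbergerYe2008, §4.6 convergence argument
(u₀ᵀa_i = 0 for indices with x_i > 0)] -/
theorem restricted_complementary_slackness (A : Matrix m n ℝ) {b y u : m → ℝ} {x : n → ℝ}
    (P : Set n) (hAxy : A *ᵥ x + y = b) (hx : ∀ j, 0 ≤ x j) (hxP : ∀ j, j ∉ P → x j = 0)
    (hy : ∀ i, 0 ≤ y i) (huP : ∀ j, j ∈ P → (Aᵀ *ᵥ u) j ≤ 0) (hu1 : ∀ i, u i ≤ 1)
    (heq : u ⬝ᵥ b = ∑ i, y i) {j : n} (hj : 0 < x j) : (Aᵀ *ᵥ u) j = 0 := by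
  have hterm : ∀ l, (Aᵀ *ᵥ u) l * x l ≤ 0 := fun l => by
    by_cases hl : l ∈ P
    · exact mul_nonpos_of_nonpos_of_nonneg (huP l hl) (hx l)
    · rw [hxP l hl, mul_zero]
  have h2 : u ⬝ᵥ y ≤ ∑ i, y i := by
    unfold dotProduct
    exact Finset.sum_le_sum fun i _ => by nlinarith [hu1 i, hy i]
  have hsum : ∑ l, (Aᵀ *ᵥ u) l * x l = 0 := by
    have hb : u ⬝ᵥ b = ∑ l, (Aᵀ *ᵥ u) l * x l + u ⬝ᵥ y := by
      rw [← hAxy, dotProduct_add, dotProduct_mulVec, ← mulVec_transpose]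
      rfl
    have hle : ∑ l, (Aᵀ *ᵥ u) l * x l ≤ 0 := Finset.sum_nonpos fun l _ => hterm l
    linarith
  have hj' := (Finset.sum_eq_zero_iff_of_nonpos fun l _ => hterm l).1 hsum j (Finset.mem_univ j)
  rcases mul_eq_zero.1 hj' with h | h
  · exact h
  · exact absurd h hj.ne'

omit [Fintype n] in
/-- `λ_εᵀA = λ₀ᵀA + εu₀ᵀA`, componentwise. [cite: LuenbergerYe2008, §4.6 Step 3
(λ_εᵀa_j = λ₀ᵀa_j + εu₀ᵀa_j)] -/
theorem transpose_mulVec_pdMove (A : Matrix m n ℝ) (lam0 u : m → ℝ) (ε : ℝ) (j : n) :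
    (Aᵀ *ᵥ pdMove lam0 u ε) j = (Aᵀ *ᵥ lam0) j + ε * (Aᵀ *ᵥ u) j := by
  unfold pdMove
  rw [mulVec_add, mulVec_smul, Pi.add_apply, Pi.smul_apply, smul_eq_mul]

/-- `λ_εᵀb = λ₀ᵀb + εu₀ᵀb`. [cite: LuenbergerYe2008, §4.6 convergence argument
(λ_εᵀb = λ₀ᵀb + εu₀ᵀb)] -/
theorem pdMove_dotProduct_rhs (lam0 u b : m → ℝ) (ε : ℝ) :
    pdMove lam0 u ε ⬝ᵥ b = lam0 ⬝ᵥ b + ε * (u ⬝ᵥ b) := by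
  unfold pdMove
  rw [add_dotProduct, smul_dotProduct, smul_eq_mul]

omit [Fintype n] in
/-- Step 3, first case: if `u₀ᵀa_j ≤ 0` for all `j`, then `λ_ε` is dual feasible for every
`ε ≥ 0`. [cite: LuenbergerYe2008, §4.6 convergence argument ("λ_ε is feasible for the dual
problem for all positive ε, since u₀ᵀA ≤ 0")] -/
theorem pdMove_dual_feasible_of_nonpos (A : Matrix m n ℝ) {lam0 u : m → ℝ} {c : n → ℝ}
    (hlam : ∀ j, (Aᵀ *ᵥ lam0) j ≤ c j) (hu : ∀ j, (Aᵀ *ᵥ u) j ≤ 0) {ε : ℝ} (hε : 0 ≤ ε) (j : n) :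
    (Aᵀ *ᵥ pdMove lam0 u ε) j ≤ c j := by
  rw [transpose_mulVec_pdMove]
  nlinarith [hlam j, hu j]

omit [Fintype n] in
/-- Step 3, first case: with `u₀ᵀb > 0` (`= 1ᵀy`, the positive restricted value) and `u₀ᵀA ≤ 0`
the dual objective is unbounded along dual feasible `λ_ε`.
[cite: LuenbergerYe2008, §4.6 convergence argument ("as ε is increased we obtain an unbounded
solution to the dual")] -/
theorem dual_unbounded_of_nonpos (A : Matrix m n ℝ) {lam0 u b : m → ℝ} {c : n → ℝ}
    (hlam : ∀ j, (Aᵀ *ᵥ lam0) j ≤ c j) (hu : ∀ j, (Aᵀ *ᵥ u) j ≤ 0) (hub : 0 < u ⬝ᵥ b) (M : ℝ) :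
    ∃ ε : ℝ, 0 ≤ ε ∧ (∀ j, (Aᵀ *ᵥ pdMove lam0 u ε) j ≤ c j) ∧ M < pdMove lam0 u ε ⬝ᵥ b := by
  refine ⟨max 0 ((M - lam0 ⬝ᵥ b) / (u ⬝ᵥ b) + 1), le_max_left _ _,
    pdMove_dual_feasible_of_nonpos A hlam hu (le_max_left _ _), ?_⟩
  rw [pdMove_dotProduct_rhs]
  have h1 : ((M - lam0 ⬝ᵥ b) / (u ⬝ᵥ b) + 1) * (u ⬝ᵥ b) = (M - lam0 ⬝ᵥ b) + u ⬝ᵥ b := by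
    rw [add_mul, one_mul, div_mul_cancel₀ _ hub.ne']
  have h2 : ((M - lam0 ⬝ᵥ b) / (u ⬝ᵥ b) + 1) * (u ⬝ᵥ b) ≤
      max 0 ((M - lam0 ⬝ᵥ b) / (u ⬝ᵥ b) + 1) * (u ⬝ᵥ b) :=
    mul_le_mul_of_nonneg_right (le_max_right _ _) hub.le
  nlinarith

/-- Step 3, first case, conclusion: if `u₀ᵀA ≤ 0` and `u₀ᵀb > 0` then the primal (15) has no
feasible solution (for a feasible `x`, `0 < u₀ᵀb = u₀ᵀAx ≤ 0`). [cite: LuenbergerYe2008, §4.6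
Step 3 ("conclude the primal has no feasible solutions")] -/
theorem primal_infeasible_of_nonpos (A : Matrix m n ℝ) {u b : m → ℝ} (hu : ∀ j, (Aᵀ *ᵥ u) j ≤ 0)
    (hub : 0 < u ⬝ᵥ b) : ¬ ∃ x : n → ℝ, A *ᵥ x = b ∧ ∀ j, 0 ≤ x j := by
  rintro ⟨x, hAx, hx⟩
  have h : u ⬝ᵥ b ≤ 0 := by
    rw [← hAx, dotProduct_mulVec, ← mulVec_transpose]
    exact Finset.sum_nonpos fun j _ => mul_nonpos_of_nonpos_of_nonneg (hu j) (hx j)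
  linarith

/-- The ratios of Step 3 are positive on the candidates: `j ∉ P` (`λ₀ᵀa_j < c_j`) and
`u₀ᵀa_j > 0` give `(c_j − λ₀ᵀa_j)/u₀ᵀa_j > 0`, so `ε₀ > 0`.
[cite: LuenbergerYe2008, §4.6 Step 3 ratio ε₀ and "This determines ε₀ > 0 and k"] -/
theorem pdRatio_pos {z c w : ℝ} (hz : z < c) (hw : 0 < w) : 0 < (c - z) / w :=
  div_pos (by linarith) hw

omit [Fintype n] in
/-- Step 3, ratio: for `0 ≤ ε ≤ (c_j − λ₀ᵀa_j)/u₀ᵀa_j` whenever `u₀ᵀa_j > 0` (in particular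
`ε = ε₀`, the minimum ratio) the vector `λ_ε` is again dual feasible.
[cite: LuenbergerYe2008, §4.6 Step 3 ("define the new dual feasible vector λ = λ₀ + ε₀u₀")] -/
theorem pdMove_dual_feasible_of_le_ratio (A : Matrix m n ℝ) {lam0 u : m → ℝ} {c : n → ℝ}
    (hlam : ∀ j, (Aᵀ *ᵥ lam0) j ≤ c j) {ε : ℝ} (hε : 0 ≤ ε)
    (hratio : ∀ j, 0 < (Aᵀ *ᵥ u) j → ε ≤ (c j - (Aᵀ *ᵥ lam0) j) / (Aᵀ *ᵥ u) j) (j : n) :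
    (Aᵀ *ᵥ pdMove lam0 u ε) j ≤ c j := by
  rw [transpose_mulVec_pdMove]
  by_cases hw : 0 < (Aᵀ *ᵥ u) j
  · have h := hratio j hw
    rw [le_div_iff₀ hw] at h
    linarith
  · have hw' := not_lt.mp hw
    nlinarith [hlam j, hw']

omit [Fintype n] in
/-- Step 3, ratio: at `ε₀ = (c_k − λ₀ᵀa_k)/u₀ᵀa_k` (`u₀ᵀa_k > 0`) the `k`th dual constraint
becomes active, `λᵀa_k = c_k`: "the corresponding new set P now includes the index k".
[cite: LuenbergerYe2008, §4.6 Step 3 and convergence argument] -/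
theorem pdMove_tight_at_ratio (A : Matrix m n ℝ) (lam0 u : m → ℝ) (c : n → ℝ) {kk : n}
    (hw : 0 < (Aᵀ *ᵥ u) kk) :
    (Aᵀ *ᵥ pdMove lam0 u ((c kk - (Aᵀ *ᵥ lam0) kk) / (Aᵀ *ᵥ u) kk)) kk = c kk := by
  rw [transpose_mulVec_pdMove, div_mul_cancel₀ _ hw.ne']
  ring

omit [Fintype n] in
/-- Indices `i ∈ P` with `u₀ᵀa_i = 0` (those with `x_i > 0`, by complementary slackness) remain
active: `λ_εᵀa_i = λ₀ᵀa_i = c_i` — "the old optimal solution is feasible for the new associated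
restricted primal". [cite: LuenbergerYe2008, §4.6 convergence argument] -/
theorem pdMove_active_of_orthogonal (A : Matrix m n ℝ) {lam0 u : m → ℝ} {c : n → ℝ} {i : n}
    (hi : (Aᵀ *ᵥ lam0) i = c i) (hu : (Aᵀ *ᵥ u) i = 0) (ε : ℝ) :
    (Aᵀ *ᵥ pdMove lam0 u ε) i = c i := by
  rw [transpose_mulVec_pdMove, hu, mul_zero, add_zero, hi]

/-- The dual objective strictly increases: `λᵀb = λ₀ᵀb + ε₀u₀ᵀb > λ₀ᵀb` for `ε₀ > 0`,
`u₀ᵀb > 0`. [cite: LuenbergerYe2008, §4.6 convergence argument ("an increased value of the dual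
objective")] -/
theorem pdMove_objective_gt (lam0 u b : m → ℝ) (hub : 0 < u ⬝ᵥ b) {ε : ℝ} (hε : 0 < ε) :
    lam0 ⬝ᵥ b < pdMove lam0 u ε ⬝ᵥ b := by
  rw [pdMove_dotProduct_rhs]
  nlinarith

end Literature.Analysis.Convex.PrimalDualRestrictedPrimal
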